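import Mathlib
import Summits.NavierStokesRegularity.NavierStokesRegularity.Theorems.ThreadingFluxHorizonTowerMixedBracketCoreA
import HarnessLib

/-!
# Crux `PoloidalLiouville` (stmt-NavierStokesRegularity-1222, W1/W2), crux idea «horizon-threading-tower» (ns-idea-15):
# MIXED-DEGREE BRACKET RIGIDITY, core B — the divergence identity, the second Cramer decomposition and its curl

Support file (Theorems-side tooling; seat ns-wall-eng-3 g3, cell ns-wall-extremal, W1 adjunct; `--supports
stmt-NavierStokesRegularity-1222`, helper).  Part of the kernel proof of ★ MIXED-DEGREE BRACKET RIGIDITY: two non-zero real solid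
harmonics `A`, `B` on `ℝ³` of DIFFERENT degrees `l ≠ m` whose loop bracket `det(x, ∇A, ∇B)` vanishes identically are zonal about a
common axis — equivalently (ns-idea-15 «horizon-threading-tower», `OrderOneSphereEuler`): a TWO-SHELL scale-free profile
`U = U_{H_l} + U_{H_m}` passes the ORDER-ONE horizon law only if it is axisymmetric without swirl (the two-shell case of the conjecture
`HorizonTower.HorizonTowerZonality` at order one).  METHOD (pure polynomial algebra in `ℝ[x₀,x₁,x₂]`, formal partial derivatives):
Cramer decomposition `|x×∇A|²·∇B = P₁ x + P₂ ∇A`; its curl (⇒ `P₁/|x×∇A|²`, `P₂/|x×∇A|²` are first integrals of `L = (x × ∇A)·∇`)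
and divergence; the gradient of `β = P₂/|x×∇A|²` decomposed once more (`|x×∇A|²·∇β ∝ c₁ x + M ∇A`) and its curl; then
`L` applied to the divergence identity gives `N · ρ · det(∇A, ∇|∇A|², x) = 0` in the domain `ℝ[x]` with `N = (m+1)ρP₁ + l(m−l)AP₂`;
the branch `N = 0` forces `A∇B − B∇A` radial and dies on `(m−l)(l+m+1)AB = 0`; so `A` is det-zonal, hence zonal by ns-wall-eng-5 g4's
`Zonal.detZonal_allDegrees` machinery, and `B` follows by `Zonal.zonal_partner_of_bracket` (p688869).
HONEST LABEL: algebra toward one crux idea's typed conjecture; `HorizonTowerZonality` (general profiles), `PoloidalLiouville` (1222),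
`UnthreadedRigidity` (27585), 23843 and NS regularity remain OPEN; W1/W2 movement 0.  [folklore]
-/

-- the summit and its single problem share the name (D-0017 nested layout)
set_option linter.dupNamespace false

noncomputable section

open MvPolynomial Finsupp

namespace Summit.NavierStokesRegularity.NavierStokesRegularity.Theorems.PoloidalLiouville.HorizonTower.Zonal

section Stages

variable {l m : ℕ} {A B : RPoly}

/-- Stage I3: the divergence identity `(m+1)P₁Wq + Wq(∇A·∇P₂) − P₂(∇A·∇Wq) = 0`. -/
theorem stageI3 (hl : 1 ≤ l) (hm : 1 ≤ m) (hA : A.IsHomogeneous l) (hB : B.IsHomogeneous m) (hlA : lapP A = 0)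
    (hlB : lapP B = 0) (hD : detP A B = 0) :
    (C (m : ℝ) + 1) * pone l m A B * wq l A
      + wq l A * (pderiv 0 A * pderiv 0 (ptwo l m A B) + pderiv 1 A * pderiv 1 (ptwo l m A B) + pderiv 2 A * pderiv 2 (ptwo l m A B))
      - ptwo l m A B * (pderiv 0 A * pderiv 0 (wq l A) + pderiv 1 A * pderiv 1 (wq l A) + pderiv 2 A * pderiv 2 (wq l A)) = 0 := by
  set a0 := pderiv 0 A with ha0
  set a1 := pderiv 1 A with ha1
  set a2 := pderiv 2 A with ha2
  set b0 := pderiv 0 B with hb0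
  set b1 := pderiv 1 B with hb1
  set b2 := pderiv 2 B with hb2
  set ρ : RPoly := rhoP with hρ'
  set G : RPoly := gP A with hG'
  set H : RPoly := hP A B with hH'
  set Wq : RPoly := wq l A with hWq'
  set P₁ : RPoly := pone l m A B with hP₁'
  set P₂ : RPoly := ptwo l m A B with hP₂'
  have hρ : ρ = X 0 ^ 2 + X 1 ^ 2 + X 2 ^ 2 := by rw [hρ']; rfl
  have hG : G = a0 * a0 + a1 * a1 + a2 * a2 := by rw [hG', ha0, ha1, ha2]; rfl
  have hH : H = a0 * b0 + a1 * b1 + a2 * b2 := by rw [hH', ha0, ha1, ha2, hb0, hb1, hb2]; rfl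
  have hWq : Wq = ρ * G - C (l : ℝ) * C (l : ℝ) * A * A := by rw [hWq', hρ', hG']; rfl
  have hP₁ : P₁ = C (m : ℝ) * B * G - C (l : ℝ) * A * H := by rw [hP₁', hG', hH']; rfl
  have hP₂ : P₂ = ρ * H - C (l : ℝ) * C (m : ℝ) * A * B := by rw [hP₂', hρ', hH']; rfl
  have sa01 : pderiv 1 a0 = pderiv 0 a1 := by rw [ha0, ha1, pderiv_comm_real]
  have sa02 : pderiv 2 a0 = pderiv 0 a2 := by rw [ha0, ha2, pderiv_comm_real]
  have sa12 : pderiv 2 a1 = pderiv 1 a2 := by rw [ha1, ha2, pderiv_comm_real]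
  have sb01 : pderiv 1 b0 = pderiv 0 b1 := by rw [hb0, hb1, pderiv_comm_real]
  have sb02 : pderiv 2 b0 = pderiv 0 b2 := by rw [hb0, hb2, pderiv_comm_real]
  have sb12 : pderiv 2 b1 = pderiv 1 b2 := by rw [hb1, hb2, pderiv_comm_real]
  have lapA : pderiv 0 a0 + pderiv 1 a1 + pderiv 2 a2 = 0 := by rw [ha0, ha1, ha2]; exact hlA
  have lapB : pderiv 0 b0 + pderiv 1 b1 + pderiv 2 b2 = 0 := by rw [hb0, hb1, hb2]; exact hlB
  have eA : X 0 * a0 + X 1 * a1 + X 2 * a2 = C (l : ℝ) * A := by rw [ha0, ha1, ha2, euler3 hA]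
  have eB : X 0 * b0 + X 1 * b1 + X 2 * b2 = C (m : ℝ) * B := by rw [hb0, hb1, hb2, euler3 hB]
  have hD' : (X 1 * a2 - X 2 * a1) * b0 + (X 2 * a0 - X 0 * a2) * b1 + (X 0 * a1 - X 1 * a0) * b2 = 0 := by
    rw [ha0, ha1, ha2, hb0, hb1, hb2, ← detP_eq_w, hD]
  have LdP : ∀ Q : RPoly, detP A Q = (X 1 * a2 - X 2 * a1) * pderiv 0 Q + (X 2 * a0 - X 0 * a2) * pderiv 1 Q
      + (X 0 * a1 - X 1 * a0) * pderiv 2 Q := fun Q => by rw [detP_eq_w]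
  obtain ⟨E0, E1, E2⟩ := stageE hA hB hlA hlB hD
  -- homogeneity of the composite polynomials (for Euler)
  have hρh : ρ.IsHomogeneous 2 := by
    rw [hρ]; exact ((isHomogeneous_X_pow 0 2).add (isHomogeneous_X_pow 1 2)).add (isHomogeneous_X_pow 2 2)
  have hGh : G.IsHomogeneous (l - 1 + (l - 1)) := by
    rw [hG, ha0, ha1, ha2]
    exact ((hA.pderiv.mul hA.pderiv).add (hA.pderiv.mul hA.pderiv)).add (hA.pderiv.mul hA.pderiv)
  have hHh : H.IsHomogeneous (l - 1 + (m - 1)) := by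
    rw [hH, ha0, ha1, ha2, hb0, hb1, hb2]
    exact ((hA.pderiv.mul hB.pderiv).add (hA.pderiv.mul hB.pderiv)).add (hA.pderiv.mul hB.pderiv)
  have hWqh : Wq.IsHomogeneous (2 * l) := by
    have h1 : (ρ * G).IsHomogeneous (2 * l) := by
      have := hρh.mul hGh; rwa [show 2 + (l - 1 + (l - 1)) = 2 * l by omega] at this
    have h2 : (C (l : ℝ) * C (l : ℝ) * A * A).IsHomogeneous (2 * l) := by
      have := ((hA.C_mul (l : ℝ)).C_mul (l : ℝ)).mul hA
      rw [show l + l = 2 * l by omega] at this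
      convert this using 2; ring
    rw [hWq]; exact h1.sub h2
  have hP₁h : P₁.IsHomogeneous (m + 2 * l - 2) := by
    have h1 : (C (m : ℝ) * B * G).IsHomogeneous (m + 2 * l - 2) := by
      have := (hB.C_mul (m : ℝ)).mul hGh; rwa [show m + (l - 1 + (l - 1)) = m + 2 * l - 2 by omega] at this
    have h2 : (C (l : ℝ) * A * H).IsHomogeneous (m + 2 * l - 2) := by
      have := (hA.C_mul (l : ℝ)).mul hHh; rwa [show l + (l - 1 + (m - 1)) = m + 2 * l - 2 by omega] at this
    rw [hP₁]; exact h1.sub h2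
  have hP₂h : P₂.IsHomogeneous (l + m) := by
    have h1 : (ρ * H).IsHomogeneous (l + m) := by
      have := hρh.mul hHh; rwa [show 2 + (l - 1 + (m - 1)) = l + m by omega] at this
    have h2 : (C (l : ℝ) * C (m : ℝ) * A * B).IsHomogeneous (l + m) := by
      have := ((hA.C_mul (m : ℝ)).C_mul (l : ℝ)).mul hB
      convert this using 2; ring
    rw [hP₂]; exact h1.sub h2
  have eWq : X 0 * pderiv 0 Wq + X 1 * pderiv 1 Wq + X 2 * pderiv 2 Wq = C ((2 * l : ℕ) : ℝ) * Wq := euler3 hWqh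
  have eP₁ : X 0 * pderiv 0 P₁ + X 1 * pderiv 1 P₁ + X 2 * pderiv 2 P₁ = C ((m + 2 * l - 2 : ℕ) : ℝ) * P₁ := euler3 hP₁h
  have eP₂ : X 0 * pderiv 0 P₂ + X 1 * pderiv 1 P₂ + X 2 * pderiv 2 P₂ = C ((l + m : ℕ) : ℝ) * P₂ := euler3 hP₂h
  have castP₁ : (C ((m + 2 * l - 2 : ℕ) : ℝ) : RPoly) = C (m : ℝ) + C 2 * C (l : ℝ) - C 2 := by
    rw [← map_mul, ← map_add, ← map_sub]; congr 1; rw [Nat.cast_sub (by omega), Nat.cast_add, Nat.cast_mul]; push_cast; ring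
  have castWq : (C ((2 * l : ℕ) : ℝ) : RPoly) = C 2 * C (l : ℝ) := by rw [← map_mul]; congr 1; push_cast; ring
  have castP₂ : (C ((l + m : ℕ) : ℝ) : RPoly) = C (l : ℝ) + C (m : ℝ) := by rw [← map_add]; congr 1; push_cast; ring
  rw [castP₁] at eP₁
  rw [castWq] at eWq
  rw [castP₂] at eP₂
  -- I3 (divergence of I1): `(m+1) P₁ Wq + Wq (a·∇P₂) − P₂ (a·∇Wq) = 0`
  have I3 : (C (m : ℝ) + 1) * P₁ * Wq + Wq * (a0 * pderiv 0 P₂ + a1 * pderiv 1 P₂ + a2 * pderiv 2 P₂)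
      - P₂ * (a0 * pderiv 0 Wq + a1 * pderiv 1 Wq + a2 * pderiv 2 Wq) = 0 := by
    have h0 := congrArg (pderiv 0) E0
    have h1 := congrArg (pderiv 1) E1
    have h2 := congrArg (pderiv 2) E2
    simp only [Derivation.leibniz, smul_eq_mul, map_add, pderiv_X_self] at h0 h1 h2
    -- `Σᵢ ∂ᵢ Eᵢ` with `Σ ∂ᵢ bᵢ = 0`, `Σ ∂ᵢ aᵢ = 0` and Euler for `P₁`
    have div1 : pderiv 0 Wq * b0 + pderiv 1 Wq * b1 + pderiv 2 Wq * b2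
        = (C (m : ℝ) + C 2 * C (l : ℝ) - C 2) * P₁ + 3 * P₁ + (a0 * pderiv 0 P₂ + a1 * pderiv 1 P₂ + a2 * pderiv 2 P₂) := by
      linear_combination h0 + h1 + h2 - Wq * lapB + P₂ * lapA + eP₁
    -- times `Wq`, with `Eᵢ` again and Euler for `Wq`
    have h3 : Wq * (pderiv 0 Wq * b0 + pderiv 1 Wq * b1 + pderiv 2 Wq * b2)
        = C 2 * C (l : ℝ) * P₁ * Wq + P₂ * (a0 * pderiv 0 Wq + a1 * pderiv 1 Wq + a2 * pderiv 2 Wq) := by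
      linear_combination pderiv 0 Wq * E0 + pderiv 1 Wq * E1 + pderiv 2 Wq * E2 + P₁ * eWq
    have hC2 : (C (2 : ℝ) : RPoly) = 2 := map_ofNat C 2
    rw [div1, hC2] at h3
    linear_combination h3
  exact I3

/-- Stage Q: `w·p = 0` and the second Cramer decomposition `Wq pᵢ = c₁ xᵢ + M ∂ᵢA`. -/
theorem stageQ (hA : A.IsHomogeneous l) (hB : B.IsHomogeneous m) (hlA : lapP A = 0) (hlB : lapP B = 0)
    (hD : detP A B = 0) :
    wq l A * pv l m A B 0 = cone l m A B * X 0 + mm l m A B * pderiv 0 A ∧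
    wq l A * pv l m A B 1 = cone l m A B * X 1 + mm l m A B * pderiv 1 A ∧
    wq l A * pv l m A B 2 = cone l m A B * X 2 + mm l m A B * pderiv 2 A := by
  set a0 := pderiv 0 A with ha0
  set a1 := pderiv 1 A with ha1
  set a2 := pderiv 2 A with ha2
  set b0 := pderiv 0 B with hb0
  set b1 := pderiv 1 B with hb1
  set b2 := pderiv 2 B with hb2
  set ρ : RPoly := rhoP with hρ'
  set G : RPoly := gP A with hG'
  set H : RPoly := hP A B with hH'
  set Wq : RPoly := wq l A with hWq'
  set P₁ : RPoly := pone l m A B with hP₁'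
  set P₂ : RPoly := ptwo l m A B with hP₂'
  have hρ : ρ = X 0 ^ 2 + X 1 ^ 2 + X 2 ^ 2 := by rw [hρ']; rfl
  have hG : G = a0 * a0 + a1 * a1 + a2 * a2 := by rw [hG', ha0, ha1, ha2]; rfl
  have hH : H = a0 * b0 + a1 * b1 + a2 * b2 := by rw [hH', ha0, ha1, ha2, hb0, hb1, hb2]; rfl
  have hWq : Wq = ρ * G - C (l : ℝ) * C (l : ℝ) * A * A := by rw [hWq', hρ', hG']; rfl
  have hP₁ : P₁ = C (m : ℝ) * B * G - C (l : ℝ) * A * H := by rw [hP₁', hG', hH']; rfl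
  have hP₂ : P₂ = ρ * H - C (l : ℝ) * C (m : ℝ) * A * B := by rw [hP₂', hρ', hH']; rfl
  have sa01 : pderiv 1 a0 = pderiv 0 a1 := by rw [ha0, ha1, pderiv_comm_real]
  have sa02 : pderiv 2 a0 = pderiv 0 a2 := by rw [ha0, ha2, pderiv_comm_real]
  have sa12 : pderiv 2 a1 = pderiv 1 a2 := by rw [ha1, ha2, pderiv_comm_real]
  have sb01 : pderiv 1 b0 = pderiv 0 b1 := by rw [hb0, hb1, pderiv_comm_real]
  have sb02 : pderiv 2 b0 = pderiv 0 b2 := by rw [hb0, hb2, pderiv_comm_real]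
  have sb12 : pderiv 2 b1 = pderiv 1 b2 := by rw [hb1, hb2, pderiv_comm_real]
  have lapA : pderiv 0 a0 + pderiv 1 a1 + pderiv 2 a2 = 0 := by rw [ha0, ha1, ha2]; exact hlA
  have lapB : pderiv 0 b0 + pderiv 1 b1 + pderiv 2 b2 = 0 := by rw [hb0, hb1, hb2]; exact hlB
  have eA : X 0 * a0 + X 1 * a1 + X 2 * a2 = C (l : ℝ) * A := by rw [ha0, ha1, ha2, euler3 hA]
  have eB : X 0 * b0 + X 1 * b1 + X 2 * b2 = C (m : ℝ) * B := by rw [hb0, hb1, hb2, euler3 hB]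
  have hD' : (X 1 * a2 - X 2 * a1) * b0 + (X 2 * a0 - X 0 * a2) * b1 + (X 0 * a1 - X 1 * a0) * b2 = 0 := by
    rw [ha0, ha1, ha2, hb0, hb1, hb2, ← detP_eq_w, hD]
  have LdP : ∀ Q : RPoly, detP A Q = (X 1 * a2 - X 2 * a1) * pderiv 0 Q + (X 2 * a0 - X 0 * a2) * pderiv 1 Q
      + (X 0 * a1 - X 1 * a0) * pderiv 2 Q := fun Q => by rw [detP_eq_w]
  set p0 := pv l m A B 0 with hp0'
  set p1 := pv l m A B 1 with hp1'
  set p2 := pv l m A B 2 with hp2'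
  have hp0 : p0 = Wq * pderiv 0 P₂ - P₂ * pderiv 0 Wq := by rw [hp0', hWq', hP₂']; rfl
  have hp1 : p1 = Wq * pderiv 1 P₂ - P₂ * pderiv 1 Wq := by rw [hp1', hWq', hP₂']; rfl
  have hp2 : p2 = Wq * pderiv 2 P₂ - P₂ * pderiv 2 Wq := by rw [hp2', hWq', hP₂']; rfl
  set PX := pxs l m A B with hPX'
  set PA := pas l m A B with hPA'
  have hPX : PX = X 0 * p0 + X 1 * p1 + X 2 * p2 := by rw [hPX', hp0', hp1', hp2']; rfl
  have hPA : PA = a0 * p0 + a1 * p1 + a2 * p2 := by rw [hPA', ha0, ha1, ha2, hp0', hp1', hp2']; rfl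
  set c₁ := cone l m A B with hc₁'
  set M := mm l m A B with hM'
  have hc₁ : c₁ = PX * G - PA * (C (l : ℝ) * A) := by rw [hc₁', hPX', hPA', hG']; rfl
  have hM : M = PA * ρ - PX * (C (l : ℝ) * A) := by rw [hM', hPX', hPA', hρ']; rfl
  obtain ⟨F1, F2⟩ := stageF hA hB hlA hlB hD
  have I5 : (X 1 * a2 - X 2 * a1) * p0 + (X 2 * a0 - X 0 * a2) * p1 + (X 0 * a1 - X 1 * a0) * p2 = 0 := by
    have h := F2; rw [LdP, LdP] at h
    rw [hp0, hp1, hp2]; linear_combination h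
  have Q0 : Wq * p0 = c₁ * X 0 + M * a0 := by
    have cr : (ρ * G - (X 0 * a0 + X 1 * a1 + X 2 * a2) * (X 0 * a0 + X 1 * a1 + X 2 * a2)) * p0
        = ((X 0 * p0 + X 1 * p1 + X 2 * p2) * G - (a0 * p0 + a1 * p1 + a2 * p2) * (X 0 * a0 + X 1 * a1 + X 2 * a2)) * X 0
          + ((a0 * p0 + a1 * p1 + a2 * p2) * ρ - (X 0 * p0 + X 1 * p1 + X 2 * p2) * (X 0 * a0 + X 1 * a1 + X 2 * a2)) * a0
          + ((X 1 * a2 - X 2 * a1) * p0 + (X 2 * a0 - X 0 * a2) * p1 + (X 0 * a1 - X 1 * a0) * p2) * (X 1 * a2 - X 2 * a1) := by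
      rw [hρ, hG]; ring
    rw [eA, I5, zero_mul, add_zero, ← hPX, ← hPA] at cr
    rw [hWq, hc₁, hM]
    linear_combination cr
  have Q1 : Wq * p1 = c₁ * X 1 + M * a1 := by
    have cr : (ρ * G - (X 0 * a0 + X 1 * a1 + X 2 * a2) * (X 0 * a0 + X 1 * a1 + X 2 * a2)) * p1
        = ((X 0 * p0 + X 1 * p1 + X 2 * p2) * G - (a0 * p0 + a1 * p1 + a2 * p2) * (X 0 * a0 + X 1 * a1 + X 2 * a2)) * X 1
          + ((a0 * p0 + a1 * p1 + a2 * p2) * ρ - (X 0 * p0 + X 1 * p1 + X 2 * p2) * (X 0 * a0 + X 1 * a1 + X 2 * a2)) * a1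
          + ((X 1 * a2 - X 2 * a1) * p0 + (X 2 * a0 - X 0 * a2) * p1 + (X 0 * a1 - X 1 * a0) * p2) * (X 2 * a0 - X 0 * a2) := by
      rw [hρ, hG]; ring
    rw [eA, I5, zero_mul, add_zero, ← hPX, ← hPA] at cr
    rw [hWq, hc₁, hM]
    linear_combination cr
  have Q2 : Wq * p2 = c₁ * X 2 + M * a2 := by
    have cr : (ρ * G - (X 0 * a0 + X 1 * a1 + X 2 * a2) * (X 0 * a0 + X 1 * a1 + X 2 * a2)) * p2
        = ((X 0 * p0 + X 1 * p1 + X 2 * p2) * G - (a0 * p0 + a1 * p1 + a2 * p2) * (X 0 * a0 + X 1 * a1 + X 2 * a2)) * X 2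
          + ((a0 * p0 + a1 * p1 + a2 * p2) * ρ - (X 0 * p0 + X 1 * p1 + X 2 * p2) * (X 0 * a0 + X 1 * a1 + X 2 * a2)) * a2
          + ((X 1 * a2 - X 2 * a1) * p0 + (X 2 * a0 - X 0 * a2) * p1 + (X 0 * a1 - X 1 * a0) * p2) * (X 0 * a1 - X 1 * a0) := by
      rw [hρ, hG]; ring
    rw [eA, I5, zero_mul, add_zero, ← hPX, ← hPA] at cr
    rw [hWq, hc₁, hM]
    linear_combination cr
  exact ⟨Q0, Q1, Q2⟩

/-- Stage I8: `Wq · L M = 3 M · L Wq` (curl of stage Q, using that `p/Wq²` is a gradient). -/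
theorem stageI8 (hA : A.IsHomogeneous l) (hB : B.IsHomogeneous m) (hlA : lapP A = 0) (hlB : lapP B = 0)
    (hD : detP A B = 0) :
    wq l A * detP A (mm l m A B) = 3 * mm l m A B * detP A (wq l A) := by
  set a0 := pderiv 0 A with ha0
  set a1 := pderiv 1 A with ha1
  set a2 := pderiv 2 A with ha2
  set b0 := pderiv 0 B with hb0
  set b1 := pderiv 1 B with hb1
  set b2 := pderiv 2 B with hb2
  set ρ : RPoly := rhoP with hρ'
  set G : RPoly := gP A with hG'
  set H : RPoly := hP A B with hH'
  set Wq : RPoly := wq l A with hWq'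
  set P₁ : RPoly := pone l m A B with hP₁'
  set P₂ : RPoly := ptwo l m A B with hP₂'
  have hρ : ρ = X 0 ^ 2 + X 1 ^ 2 + X 2 ^ 2 := by rw [hρ']; rfl
  have hG : G = a0 * a0 + a1 * a1 + a2 * a2 := by rw [hG', ha0, ha1, ha2]; rfl
  have hH : H = a0 * b0 + a1 * b1 + a2 * b2 := by rw [hH', ha0, ha1, ha2, hb0, hb1, hb2]; rfl
  have hWq : Wq = ρ * G - C (l : ℝ) * C (l : ℝ) * A * A := by rw [hWq', hρ', hG']; rfl
  have hP₁ : P₁ = C (m : ℝ) * B * G - C (l : ℝ) * A * H := by rw [hP₁', hG', hH']; rfl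
  have hP₂ : P₂ = ρ * H - C (l : ℝ) * C (m : ℝ) * A * B := by rw [hP₂', hρ', hH']; rfl
  have sa01 : pderiv 1 a0 = pderiv 0 a1 := by rw [ha0, ha1, pderiv_comm_real]
  have sa02 : pderiv 2 a0 = pderiv 0 a2 := by rw [ha0, ha2, pderiv_comm_real]
  have sa12 : pderiv 2 a1 = pderiv 1 a2 := by rw [ha1, ha2, pderiv_comm_real]
  have sb01 : pderiv 1 b0 = pderiv 0 b1 := by rw [hb0, hb1, pderiv_comm_real]
  have sb02 : pderiv 2 b0 = pderiv 0 b2 := by rw [hb0, hb2, pderiv_comm_real]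
  have sb12 : pderiv 2 b1 = pderiv 1 b2 := by rw [hb1, hb2, pderiv_comm_real]
  have lapA : pderiv 0 a0 + pderiv 1 a1 + pderiv 2 a2 = 0 := by rw [ha0, ha1, ha2]; exact hlA
  have lapB : pderiv 0 b0 + pderiv 1 b1 + pderiv 2 b2 = 0 := by rw [hb0, hb1, hb2]; exact hlB
  have eA : X 0 * a0 + X 1 * a1 + X 2 * a2 = C (l : ℝ) * A := by rw [ha0, ha1, ha2, euler3 hA]
  have eB : X 0 * b0 + X 1 * b1 + X 2 * b2 = C (m : ℝ) * B := by rw [hb0, hb1, hb2, euler3 hB]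
  have hD' : (X 1 * a2 - X 2 * a1) * b0 + (X 2 * a0 - X 0 * a2) * b1 + (X 0 * a1 - X 1 * a0) * b2 = 0 := by
    rw [ha0, ha1, ha2, hb0, hb1, hb2, ← detP_eq_w, hD]
  have LdP : ∀ Q : RPoly, detP A Q = (X 1 * a2 - X 2 * a1) * pderiv 0 Q + (X 2 * a0 - X 0 * a2) * pderiv 1 Q
      + (X 0 * a1 - X 1 * a0) * pderiv 2 Q := fun Q => by rw [detP_eq_w]
  set p0 := pv l m A B 0 with hp0'
  set p1 := pv l m A B 1 with hp1'
  set p2 := pv l m A B 2 with hp2'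
  have hp0 : p0 = Wq * pderiv 0 P₂ - P₂ * pderiv 0 Wq := by rw [hp0', hWq', hP₂']; rfl
  have hp1 : p1 = Wq * pderiv 1 P₂ - P₂ * pderiv 1 Wq := by rw [hp1', hWq', hP₂']; rfl
  have hp2 : p2 = Wq * pderiv 2 P₂ - P₂ * pderiv 2 Wq := by rw [hp2', hWq', hP₂']; rfl
  set PX := pxs l m A B with hPX'
  set PA := pas l m A B with hPA'
  have hPX : PX = X 0 * p0 + X 1 * p1 + X 2 * p2 := by rw [hPX', hp0', hp1', hp2']; rfl
  have hPA : PA = a0 * p0 + a1 * p1 + a2 * p2 := by rw [hPA', ha0, ha1, ha2, hp0', hp1', hp2']; rfl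
  set c₁ := cone l m A B with hc₁'
  set M := mm l m A B with hM'
  have hc₁ : c₁ = PX * G - PA * (C (l : ℝ) * A) := by rw [hc₁', hPX', hPA', hG']; rfl
  have hM : M = PA * ρ - PX * (C (l : ℝ) * A) := by rw [hM', hPX', hPA', hρ']; rfl
  obtain ⟨Q0, Q1, Q2⟩ := stageQ hA hB hlA hlB hD
  -- I7: `Wq (∂ⱼpᵢ − ∂ᵢpⱼ) = 2 (∂ⱼWq pᵢ − ∂ᵢWq pⱼ)`
  have dp01 : pderiv 1 p0 = pderiv 1 Wq * pderiv 0 P₂ + Wq * pderiv 1 (pderiv 0 P₂)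
      - (pderiv 1 P₂ * pderiv 0 Wq + P₂ * pderiv 1 (pderiv 0 Wq)) := by
    rw [hp0]; simp only [map_sub, Derivation.leibniz, smul_eq_mul]; ring
  have dp10 : pderiv 0 p1 = pderiv 0 Wq * pderiv 1 P₂ + Wq * pderiv 0 (pderiv 1 P₂)
      - (pderiv 0 P₂ * pderiv 1 Wq + P₂ * pderiv 0 (pderiv 1 Wq)) := by
    rw [hp1]; simp only [map_sub, Derivation.leibniz, smul_eq_mul]; ring
  have dp12 : pderiv 2 p1 = pderiv 2 Wq * pderiv 1 P₂ + Wq * pderiv 2 (pderiv 1 P₂)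
      - (pderiv 2 P₂ * pderiv 1 Wq + P₂ * pderiv 2 (pderiv 1 Wq)) := by
    rw [hp1]; simp only [map_sub, Derivation.leibniz, smul_eq_mul]; ring
  have dp21 : pderiv 1 p2 = pderiv 1 Wq * pderiv 2 P₂ + Wq * pderiv 1 (pderiv 2 P₂)
      - (pderiv 1 P₂ * pderiv 2 Wq + P₂ * pderiv 1 (pderiv 2 Wq)) := by
    rw [hp2]; simp only [map_sub, Derivation.leibniz, smul_eq_mul]; ring
  have dp20 : pderiv 0 p2 = pderiv 0 Wq * pderiv 2 P₂ + Wq * pderiv 0 (pderiv 2 P₂)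
      - (pderiv 0 P₂ * pderiv 2 Wq + P₂ * pderiv 0 (pderiv 2 Wq)) := by
    rw [hp2]; simp only [map_sub, Derivation.leibniz, smul_eq_mul]; ring
  have dp02 : pderiv 2 p0 = pderiv 2 Wq * pderiv 0 P₂ + Wq * pderiv 2 (pderiv 0 P₂)
      - (pderiv 2 P₂ * pderiv 0 Wq + P₂ * pderiv 2 (pderiv 0 Wq)) := by
    rw [hp0]; simp only [map_sub, Derivation.leibniz, smul_eq_mul]; ring
  have I7a : Wq * (pderiv 1 p0 - pderiv 0 p1) = C 2 * (pderiv 1 Wq * p0 - pderiv 0 Wq * p1) := by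
    rw [dp01, dp10, pderiv_comm_real 1 0 P₂, pderiv_comm_real 1 0 Wq, show (C (2:ℝ) : RPoly) = 2 from map_ofNat C 2, hp0, hp1]
    ring
  have I7b : Wq * (pderiv 2 p1 - pderiv 1 p2) = C 2 * (pderiv 2 Wq * p1 - pderiv 1 Wq * p2) := by
    rw [dp12, dp21, pderiv_comm_real 2 1 P₂, pderiv_comm_real 2 1 Wq, show (C (2:ℝ) : RPoly) = 2 from map_ofNat C 2, hp1, hp2]
    ring
  have I7c : Wq * (pderiv 0 p2 - pderiv 2 p0) = C 2 * (pderiv 0 Wq * p2 - pderiv 2 Wq * p0) := by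
    rw [dp20, dp02, pderiv_comm_real 2 0 P₂, pderiv_comm_real 2 0 Wq, show (C (2:ℝ) : RPoly) = 2 from map_ofNat C 2, hp0, hp2]
    ring
  -- I8: curl of I6, dotted with `x`: `Wq · L M = 3 M · L Wq`
  have K01 : 3 * (pderiv 1 Wq * p0 - pderiv 0 Wq * p1)
      = pderiv 1 c₁ * X 0 - pderiv 0 c₁ * X 1 + pderiv 1 M * a0 - pderiv 0 M * a1 := by
    have h := congrArg (pderiv 1) Q0
    have h' := congrArg (pderiv 0) Q1
    simp only [Derivation.leibniz, smul_eq_mul, map_add, pderiv_X_of_ne (show (0:Fin 3) ≠ 1 by decide),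
      pderiv_X_of_ne (show (1:Fin 3) ≠ 0 by decide)] at h h'
    rw [sa01] at h
    have h7 := I7a
    rw [show (C (2:ℝ) : RPoly) = 2 from map_ofNat C 2] at h7
    linear_combination h - h' - h7
  have K12 : 3 * (pderiv 2 Wq * p1 - pderiv 1 Wq * p2)
      = pderiv 2 c₁ * X 1 - pderiv 1 c₁ * X 2 + pderiv 2 M * a1 - pderiv 1 M * a2 := by
    have h := congrArg (pderiv 2) Q1
    have h' := congrArg (pderiv 1) Q2
    simp only [Derivation.leibniz, smul_eq_mul, map_add, pderiv_X_of_ne (show (1:Fin 3) ≠ 2 by decide),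
      pderiv_X_of_ne (show (2:Fin 3) ≠ 1 by decide)] at h h'
    rw [sa12] at h
    have h7 := I7b
    rw [show (C (2:ℝ) : RPoly) = 2 from map_ofNat C 2] at h7
    linear_combination h - h' - h7
  have K20 : 3 * (pderiv 0 Wq * p2 - pderiv 2 Wq * p0)
      = pderiv 0 c₁ * X 2 - pderiv 2 c₁ * X 0 + pderiv 0 M * a2 - pderiv 2 M * a0 := by
    have h := congrArg (pderiv 0) Q2
    have h' := congrArg (pderiv 2) Q0
    simp only [Derivation.leibniz, smul_eq_mul, map_add, pderiv_X_of_ne (show (2:Fin 3) ≠ 0 by decide),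
      pderiv_X_of_ne (show (0:Fin 3) ≠ 2 by decide)] at h h'
    rw [← sa02] at h
    have h7 := I7c
    rw [show (C (2:ℝ) : RPoly) = 2 from map_ofNat C 2] at h7
    linear_combination h - h' - h7
  have I8 : Wq * detP A M = 3 * M * detP A Wq := by
    rw [LdP, LdP]
    linear_combination (-Wq * X 2) * K01 + (-Wq * X 0) * K12 + (-Wq * X 1) * K20
      + (3 * (X 2 * pderiv 1 Wq - X 1 * pderiv 2 Wq)) * Q0 + (3 * (X 0 * pderiv 2 Wq - X 2 * pderiv 0 Wq)) * Q1
      + (3 * (X 1 * pderiv 0 Wq - X 0 * pderiv 1 Wq)) * Q2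
  exact I8
end Stages

end Summit.NavierStokesRegularity.NavierStokesRegularity.Theorems.PoloidalLiouville.HorizonTower.Zonal

end
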